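import Mathlib.LinearAlgebra.Dual.Lemmas
import Mathlib.LinearAlgebra.Pi
import Mathlib.Tactic
import HarnessLib

/-!
# Dual vectors to finitely many linearly independent linear functionals (Hoffman–Kunze §3.6 Theorem 20, in dual-family form)

Topic `LinearAlgebra`; namespace `Literature.LinearAlgebra`.  THEOREMS ONLY (no definition, no instance, no notation, no named fact, no `sorry`); Mathlib-only imports.
Cell `pub/hodgecm-mathlib` (D-0151), crux H413 = `stmt-HodgeConjecture-24833`, line «N6nsGerm», registered print stub `stub_N6nsS3` ((S3) «identity core» = Langlands–Shelstad
local transfer at the identity for `(U(3), U(2) × U(1))`; A-p13 (g31) cost census 6d6feb27 «PRINT-XL, barrier»).  This file is census §6 (3) «C8 DENSITY LEMMA, ABSTRACT FORM»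
(staffable by an idle hand, LEAD T8-158), typed by F0P3a-p08 (g15): the REALISATION step of the (S3) print proof — «every finite combination of the (linearly independent)
stable unipotent distributions on `H_v` is the stable orbital integral functional of SOME test function `φ^H`» — is the following piece of linear algebra applied to
`V :=` the `IsLocSmooth` functions and `μ_i :=` the stable germ functionals.  HONEST LABEL: HC_CM is proved only modulo the printed citations (the 2 remaining named inputs
hLiu418, h413) until rung 0 closes; nothing about (S3) itself is asserted here.

THE STATEMENT.  [HoffmanKunze1971LinearAlgebra, §3.6 Theorem 20] (stated there for an ARBITRARY vector space `V`): «`g` is a linear combination of `f₁, …, f_r` iff the null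
space of `g` contains `N_{f₁} ∩ ⋯ ∩ N_{f_r}`».  Applied to a linearly independent family `(f_i)` and `g := f_j` it yields vectors `α_j ∈ ⋂_{i ≠ j} N_{f_i}` with `f_j(α_j) = 1`,
i.e. a DUAL FAMILY `f_i(α_j) = δ_ij`; conversely a dual family forces independence.  We prove the dual-family form directly: the evaluation map `V → (ι → K)`, `v ↦ (μ_i v)_i`,
is SURJECTIVE when `(μ_i)` is linearly independent (else a non-zero functional on `ι → K` vanishing on its range — Mathlib `Submodule.exists_dual_map_eq_bot_of_lt_top` —
would be a vanishing non-trivial combination of the `μ_i`).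

* `range_pi_eq_top_of_linearIndependent` — `LinearMap.range (LinearMap.pi μ) = ⊤` for `μ : ι → Module.Dual K V` linearly independent, `ι` finite.
* **`exists_dual_family_of_linearIndependent`** — `∃ v : ι → V, ∀ i j, μ i (v j) = if i = j then 1 else 0`.
* `exists_forall_apply_eq_of_linearIndependent` — every prescribed table of values `c : ι → K` is realised: `∃ v, ∀ i, μ i v = c i` (the «density» form used by (S3) C8).
* `linearIndependent_of_dual_family` — the converse.

## References
* [HoffmanKunze1971LinearAlgebra] K. Hoffman, R. Kunze, *Linear Algebra*, 2nd ed., Prentice-Hall (1971): §3.6, Lemma and Theorem 20 (linear functionals with prescribed null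
  spaces on an arbitrary vector space); §3.5 Theorem 15 (dual bases).
* [LanglandsShelstad1990Descent] R. Langlands, D. Shelstad, *Descent for transfer factors*, The Grothendieck Festschrift II (1990): §2.1 (2.1.2), §2.3 (local transfer at the
  identity — the consumer of the density step).
-/

set_option autoImplicit false

open Module

namespace Literature.LinearAlgebra

variable {K : Type*} [Field K] {V : Type*} [AddCommGroup V] [Module K V] {ι : Type*} [Fintype ι]

/-- **The evaluation map of a linearly independent finite family of functionals is surjective**: for `μ : ι → V^*` linearly independent over a field, `v ↦ (μ_i v)_i`
maps `V` ONTO `ι → K` (else a non-zero functional on `ι → K` vanishing on the range gives a non-trivial vanishing combination of the `μ_i`).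
[cite: HoffmanKunze1971LinearAlgebra, §3.6 Theorem 20] -/
theorem range_pi_eq_top_of_linearIndependent (μ : ι → Dual K V) (hμ : LinearIndependent K μ) :
    LinearMap.range (LinearMap.pi μ) = ⊤ := by
  classical
  by_contra hne
  obtain ⟨f, hf0, hf⟩ := Submodule.exists_dual_map_eq_bot_of_lt_top (lt_top_iff_ne_top.2 hne) inferInstance
  -- `f` vanishes on the range of the evaluation map
  have hfv : ∀ v : V, f (LinearMap.pi μ v) = 0 := fun v => by
    have h : f (LinearMap.pi μ v) ∈ (LinearMap.range (LinearMap.pi μ)).map f :=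
      Submodule.mem_map_of_mem (LinearMap.mem_range_self _ v)
    rw [hf] at h
    exact (Submodule.mem_bot K).1 h
  -- the coefficients of `f` on the standard basis give a vanishing combination of the `μ i`
  have hsum : ∑ i, f (fun j => if i = j then (1 : K) else 0) • μ i = 0 := by
    ext v
    have h := hfv v
    rw [LinearMap.pi_apply_eq_sum_univ f] at h
    rw [LinearMap.sum_apply, LinearMap.zero_apply]
    simpa only [LinearMap.smul_apply, LinearMap.pi_apply, smul_eq_mul, mul_comm] using h
  have hc := Fintype.linearIndependent_iff.1 hμ _ hsum
  -- hence `f = 0`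
  refine hf0 (LinearMap.ext fun x => ?_)
  rw [LinearMap.pi_apply_eq_sum_univ f x, LinearMap.zero_apply]
  exact Finset.sum_eq_zero fun i _ => by rw [hc i, smul_zero]

/-- **DUAL VECTORS TO INDEPENDENT FUNCTIONALS** (Hoffman–Kunze §3.6 Theorem 20 in dual-family form; `V` need NOT be finite-dimensional): for `μ : ι → V^*` linearly independent
over a field `K`, `ι` finite, there are `v_j ∈ V` with `μ_i(v_j) = δ_ij`.  (S3)-reading: the stable germ functionals being linearly independent on the test functions, each
has a dual test function. [cite: HoffmanKunze1971LinearAlgebra, §3.6 Theorem 20] -/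
theorem exists_dual_family_of_linearIndependent [DecidableEq ι] (μ : ι → Dual K V) (hμ : LinearIndependent K μ) :
    ∃ v : ι → V, ∀ i j, μ i (v j) = if i = j then 1 else 0 := by
  have hsurj : Function.Surjective (LinearMap.pi μ) := LinearMap.range_eq_top.1 (range_pi_eq_top_of_linearIndependent μ hμ)
  choose v hv using fun j : ι => hsurj (fun i => if i = j then (1 : K) else 0)
  refine ⟨v, fun i j => ?_⟩
  have h := congrFun (hv j) i
  rwa [LinearMap.pi_apply] at h

/-- **DENSITY FORM**: for `μ : ι → V^*` linearly independent (`ι` finite), EVERY table of values is realised by one vector: `∀ c, ∃ v, ∀ i, μ_i(v) = c_i` — the shape in which the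
(S3) print proof uses it («choose `φ^H` with the prescribed stable germ coefficients»). [cite: HoffmanKunze1971LinearAlgebra, §3.6 Theorem 20] -/
theorem exists_forall_apply_eq_of_linearIndependent (μ : ι → Dual K V) (hμ : LinearIndependent K μ) (c : ι → K) :
    ∃ v : V, ∀ i, μ i v = c i := by
  obtain ⟨v, hv⟩ := LinearMap.range_eq_top.1 (range_pi_eq_top_of_linearIndependent μ hμ) c
  exact ⟨v, fun i => by rw [← LinearMap.pi_apply μ v i, hv]⟩

omit [Fintype ι] in
/-- **Converse**: a family of functionals admitting a dual family of vectors is linearly independent (evaluate a vanishing combination at `v_j`).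
[cite: HoffmanKunze1971LinearAlgebra, §3.5 Theorem 15] -/
theorem linearIndependent_of_dual_family [DecidableEq ι] (μ : ι → Dual K V) (v : ι → V) (hv : ∀ i j, μ i (v j) = if i = j then (1 : K) else 0) :
    LinearIndependent K μ := by
  refine linearIndependent_iff'.2 fun s c hs j hj => ?_
  have h := congrArg (fun φ : Dual K V => φ (v j)) hs
  simpa [hv, hj] using h

/-- **Equivalence**: for a finite family of functionals over a field, linear independence ⟺ existence of a dual family of vectors.
[cite: HoffmanKunze1971LinearAlgebra, §3.6 Theorem 20] -/
theorem linearIndependent_iff_exists_dual_family [DecidableEq ι] (μ : ι → Dual K V) :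
    LinearIndependent K μ ↔ ∃ v : ι → V, ∀ i j, μ i (v j) = if i = j then (1 : K) else 0 :=
  ⟨exists_dual_family_of_linearIndependent μ, fun ⟨v, hv⟩ => linearIndependent_of_dual_family μ v hv⟩

end Literature.LinearAlgebra
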